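import Literature.Topology.FourManifolds.CorkTwistProofs
import Literature.Topology.FourManifolds.HCobordismTheoremProofs
import Literature.Topology.FourManifolds.HCobordismLevelDeformationProof
import HarnessLib

/-!
# Matveyev's Theorem part 1 with Fact 1, from the frontier of its DAG (discharge file of `CorkDecomposition.lean` §4)

Topic `Literature/Topology/FourManifolds` (fact seat
`provefact-Literature.Topology.FourManifolds.Matveyev1996_partOne_and_fact`, sibling "Proofs" file
of `CorkDecomposition.lean`, which states in its §4 the named fact
`Literature.Topology.FourManifolds.Matveyev1996_partOne_and_fact`: Matveyev, *A decomposition of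
smooth simply-connected h-cobordant 4-manifolds*, J. Differential Geom. 44 (1996) 571–582,
arXiv:dg-ga/9505001, Theorem 1 part 1 minus the `H₂` clause (p. 1) together with Fact 1 of the
proof of part 2 (p. 3: *"If `W₁`, `W₂` are homotopy balls built in the proof of the first part of
Theorem and `S⁴` is a 4-dimensional sphere with standard smooth structure, then `W₁ #_Σ W₁ ≅ S⁴`,
`W₁ #_Σ W₂ ≅ S⁴`"*), in the bundled-existential form).

`Matveyev1996_partOne_and_fact` is an interior node of the DAG of the cork decomposition theorem
`Literature.Topology.FourManifolds.corkDecomposition`: above it sit the printed two-piece form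
`Matveyev1996_decomposition` and `corkDecomposition` (both *theorems of the tree given this node*:
`Matveyev1996_partOne_and_fact.matveyev1996_decomposition`, `CorkDecompositionMatveyevForm.lean`;
`corkDecomposition_of_partOne_and_fact`, `SeamAdaptedWitnesses.lean`), below it the printed proof
(Matveyev pp. 1–3; Kirby, Turkish J. Math. 20 (1996), §§2–4) has been decomposed by the tree down
to named-fact leaves: the first sentence *"`U` has a handlebody with no 1- and 4-handles"* is
Milnor's Thm. 8.1 at one end of the 5-dimensional h-cobordism with Thms. 2.5, 4.8
(`Cobordism.IsHCobordism.exists_isMorseFunction_two_three_ordered_of_leaves`,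
`HCobordismHandlesTwoThree.lean`), Thm. 8.1 at one end is reduced to the two leaves of Milnor's
proof that are still named facts
(`Cobordism.Milnor1965_exists_isMorseFunction_two_le_index_left_of_two_leaves`,
`HCobordismLowHandlesTwoLeaves.lean`), and the rest factors through the middle level
((B) and (H4) of `CorkDecompositionMiddleLevel.lean`).
This file records the resulting assembly for *this* node, i.e. states Matveyev's part 1 with
Fact 1 as a consequence of exactly the **four named facts that remain open below it** (the
frontier, 2026-08-15 — the same frontier as `corkDecomposition`, `CorkTwistProofs.lean`):

| leaf | source | tree name |
|---|---|---|
| L3 | Milnor 1965, Thm. 5.4, Assertion 6 | `Cobordism.Milnor1965_cancellation_preliminaryHypothesis` (`HCobordismFirstCancellation.lean`) |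
| L8 | Milnor 1965, Lemma 8.3 in `V₂₊` | `Cobordism.Milnor1965_exists_idealCircle` (`HCobordismAuxiliaryPair.lean`) |
| (B) | Kirby 1996 §2 (last par.); Matveyev, Proof of Theorem, sentences 1–6 | `exists_dualSpheres_middleLevel_of_two_three` (`CorkDecompositionMiddleLevel.lean`) |
| (H4) | Matveyev pp. 1–3 with Fact 1; Kirby 1996 §3, Addenda (B), (C) | `Matveyev1996_partOne_and_fact_of_dualSpheres` (`CorkDecompositionMiddleLevel.lean`) |

* `Literature.Topology.FourManifolds.matveyev1996_partOne_and_fact_of_eightOne_middleLevel` —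
  `Matveyev1996_partOne_and_fact ⟸ Thm. 8.1 at one end ∧ (B) ∧ (H4)`;
* `Literature.Topology.FourManifolds.matveyev1996_partOne_and_fact_of_frontier` —
  `Matveyev1996_partOne_and_fact ⟸ L3 ∧ L8 ∧ (B) ∧ (H4)`.

When the four leaves are discharged, `Matveyev1996_partOne_and_fact_holds` is
`matveyev1996_partOne_and_fact_of_frontier` applied to the four `_holds`, to be appended here.
No statement (no `def`, no named fact) is introduced in this file.

**Update (2026-08-15, later).**  The h-cobordism half of this frontier has since been discharged
by the tree: L8 is the theorem `Cobordism.Milnor1965_exists_idealCircle_holds`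
(`HCobordismTheoremProofs.lean`), L3 follows from the deformation of the level diffeomorphism in
the proof of Milnor's Thm. 5.4 (`Cobordism.Milnor1965_cancellation_preliminaryHypothesis_of_levelDeformation`,
ibid.), and that deformation is the theorem `Cobordism.Milnor1965_cancellation_levelDeformation_holds`
(`HCobordismLevelDeformationProof.lean`; Milnor 1965, proof of Thm. 5.4, Assertion 6, PDF
pp. 31–32, with Thm. 5.6).  Hence Milnor's Thm. 8.1 at the incoming end of the h-cobordism —
the first sentence of Matveyev's proof, *"`U` has a handlebody with no 1- and 4-handles"* — is
a closed theorem of the tree (`Cobordism.Milnor1965_exists_isMorseFunction_two_le_index_left_holds`,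
`HCobordismTheoremProofs.lean`), and `Matveyev1996_partOne_and_fact` rests on exactly the two
Matveyev-specific leaves (B) and (H4) of the table:

* `Literature.Topology.FourManifolds.matveyev1996_partOne_and_fact_of_middleLevel_leaves` —
  `Matveyev1996_partOne_and_fact ⟸ (B) ∧ (H4)`, all of Milnor's handle theory discharged.

`Matveyev1996_partOne_and_fact_holds` will be `matveyev1996_partOne_and_fact_of_middleLevel_leaves`
applied to the discharges of (B) and (H4).

**Merge of the handlebody form (2026-08-15, D-0026 review).**  The intermediate named fact
`Matveyev1996_partOne_and_fact_of_two_three` of `CorkDecompositionHandlebody.lean` ("the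
handlebody form": the conclusion of `Matveyev1996_partOne_and_fact` for an h-cobordism *equipped
with* a two-three Morse function) was `Matveyev1996_partOne_and_fact` with one extra hypothesis,
and that hypothesis — the first sentence of the printed proof, Smale–Milnor handle trading in the
5-dimensional h-cobordism — is now a theorem of the tree
(`exists_isMorseFunction_two_three_of_isHCobordism_holds`, `HCobordismHandlesProofs.lean`;
`Milnor1965_exists_isMorseFunction_two_le_index_holds` and
`Cobordism.Milnor1965_finalRearrangement_holds`).  So the handlebody form had become
unconditionally equivalent to this node, i.e. the same proof obligation counted twice; the
D-0026 review merged it back into `Matveyev1996_partOne_and_fact`: the proofs below pass to the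
middle level directly (two-three Morse function from the discharged rungs, then (B), then (H4))
instead of going through the handlebody form, and the former bookkeeping theorems
`matveyev1996_partOne_and_fact_of_two_three_handlebody`,
`matveyev1996_partOne_and_fact_iff_two_three_handlebody` of this file are withdrawn with it.
No statement (no `def`, no named fact) is introduced in this file.

## References

* R. Matveyev, *A decomposition of smooth simply-connected h-cobordant 4-manifolds*,
  J. Differential Geom. 44 (1996) 571–582; arXiv:dg-ga/9505001: Theorem 1 (p. 1), Proof of
  Theorem (pp. 1–2), Fact 1 (p. 3). [Matveyev1996]
* R. Kirby, *Akbulut's corks and h-cobordisms of smooth, simply connected 4-manifolds*, Turkish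
  J. Math. 20 (1996) 85–93; arXiv:math/9712231, §§2–4, Addenda (B), (C). [KirbyCorks1996]
* C. L. Curtis, M. H. Freedman, W.-C. Hsiang, R. Stong, *A decomposition theorem for h-cobordant
  smooth simply-connected compact 4-manifolds*, Invent. Math. 123 (1996) 343–348, Theorem.
  [CurtisFreedmanHsiangStong1996]
* J. Milnor, *Lectures on the h-cobordism theorem*, Princeton (1965): Thm. 5.4 (Assertion 6),
  Lemma 8.3, Thm. 8.1 and its proof, proof of Thm. 9.1 (PDF pp. 27–35, 54–57).
  [MilnorHCobordism1965]
-/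

noncomputable section

namespace Literature.Topology.FourManifolds

universe u

/-- **Matveyev's Theorem part 1 with Fact 1 from Milnor's Thm. 8.1 at one end, (B) and (H4).**
`Literature.Topology.FourManifolds.Matveyev1996_partOne_and_fact` (decompositions `X₁ = W₁ ∪_{φ₁} M`,
`X₂ = W₂ ∪_{φ₂} M` of h-cobordant simply connected closed smooth 4-manifolds with `Wᵢ` compact
contractible, `M` compact, and `S⁴` the double of `W₁` and the gluing `W₁ ∪_{φ₂⁻¹ φ₁} W₂`;
Matveyev 1996, Theorem 1 part 1 and Fact 1) follows from Milnor's Thm. 8.1 at the incoming end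
of the h-cobordism (`Literature.Topology.FourManifolds.Cobordism.Milnor1965_exists_isMorseFunction_two_le_index_left`,
which with the discharged Thms. 2.5 and 4.8 gives the two-three handlebody of the first sentence
of the printed proof, `Cobordism.IsHCobordism.exists_isMorseFunction_two_three_ordered_of_leaves`
of `HCobordismHandlesTwoThree.lean`), the middle level of that handlebody (B)
(`Literature.Topology.FourManifolds.exists_dualSpheres_middleLevel_of_two_three`) and the
four-dimensional construction from the middle level on (H4)
(`Literature.Topology.FourManifolds.Matveyev1996_partOne_and_fact_of_dualSpheres`), applied in this order.
[cite: Matveyev1996, Theorem 1 part 1, Proof of Theorem and Fact 1 (arXiv pp. 1–3)]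
[cite: KirbyCorks1996, §§2–4: Theorem and Addenda (B), (C)]
[cite: MilnorHCobordism1965, Thm. 8.1 and proof of Thm. 9.1 (PDF pp. 54–57)] -/
theorem matveyev1996_partOne_and_fact_of_eightOne_middleLevel
    (h81 : Cobordism.Milnor1965_exists_isMorseFunction_two_le_index_left.{u})
    (hB : exists_dualSpheres_middleLevel_of_two_three.{u})
    (h4 : Matveyev1996_partOne_and_fact_of_dualSpheres.{u}) :
    Matveyev1996_partOne_and_fact.{u} := by
  intro X₁ X₂ _ _ _ _ _ _ _ _ _ _ _ _ _ _ hcob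
  obtain ⟨c, hc⟩ := hcob
  -- the two-three handlebody (first sentence of the printed proof): Thm. 8.1 at one end `h81`
  -- with the discharged Thm. 2.5 and Thm. 4.8
  obtain ⟨f, hf, hind⟩ := hc.exists_isMorseFunction_two_three_ordered_of_leaves
    (fun {_ _ _} _ _ _ _ => Cobordism.exists_isMorseFunction_holds) h81
    Cobordism.Milnor1965_finalRearrangement_holds
  -- the middle level (B), then the four-dimensional construction (H4)
  obtain ⟨N, _, _, _, _, _, _, _, oN, oS, oP, k, S, P, -, hD, hP, hS⟩ := hB X₁ X₂ c f hc hf hind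
  exact h4 X₁ X₂ N oN oS oP k S P hD hP hS

/-- **Matveyev's Theorem part 1 with Fact 1 from the frontier of its DAG.**
`Literature.Topology.FourManifolds.Matveyev1996_partOne_and_fact` follows from the four named facts still
open below it: Assertion 6 of the proof of Milnor's First Cancellation Theorem 5.4 (L3) and
Milnor's Lemma 8.3 in `V₂₊` (L8) — which give Thm. 8.1 at one end of the h-cobordism by
`Cobordism.Milnor1965_exists_isMorseFunction_two_le_index_left_of_two_leaves`
(`HCobordismLowHandlesTwoLeaves.lean`) —, the middle level of the two-three handlebody (B) and
the four-dimensional construction from the middle level on (H4); by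
`matveyev1996_partOne_and_fact_of_eightOne_middleLevel`.  Once these four named facts are
discharged, `Matveyev1996_partOne_and_fact_holds` is this theorem applied to their `_holds`.
[cite: Matveyev1996, Theorem 1 part 1, Proof of Theorem and Fact 1 (arXiv pp. 1–3)]
[cite: KirbyCorks1996, §§2–4: Theorem and Addenda (B), (C)]
[cite: MilnorHCobordism1965, Thm. 5.4 Assertion 6, Lemma 8.3, Thm. 8.1 (PDF pp. 27–35, 54–57)] -/
theorem matveyev1996_partOne_and_fact_of_frontier
    (h6 : Cobordism.Milnor1965_cancellation_preliminaryHypothesis.{u})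
    (hA : Cobordism.Milnor1965_exists_idealCircle.{u})
    (hB : exists_dualSpheres_middleLevel_of_two_three.{u})
    (h4 : Matveyev1996_partOne_and_fact_of_dualSpheres.{u}) :
    Matveyev1996_partOne_and_fact.{u} :=
  matveyev1996_partOne_and_fact_of_eightOne_middleLevel
    (Cobordism.Milnor1965_exists_isMorseFunction_two_le_index_left_of_two_leaves h6 hA) hB h4

/-! ### After the discharge of Milnor's handle theory: the two Matveyev-specific leaves -/

/-- **Matveyev's Theorem part 1 with Fact 1 from its two remaining leaves (B) and (H4).**
With Milnor's handle theory discharged — Thm. 8.1 at the incoming end of the simply connected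
5-dimensional h-cobordism is `Cobordism.Milnor1965_exists_isMorseFunction_two_le_index_left_holds`
(`HCobordismTheoremProofs.lean`), i.e. the first sentence of the printed proof, *"First, observe
that `U` has a handlebody with no 1- and 4-handles"* (Matveyev p. 1; Kirby 1996 §2), is a closed
theorem of the tree —, `Matveyev1996_partOne_and_fact` follows from
the middle level of the two-three handlebody (B)
(`Literature.Topology.FourManifolds.exists_dualSpheres_middleLevel_of_two_three`: Kirby 1996 §2,
last paragraph; Matveyev, Proof of Theorem, sentences 1–6) and the four-dimensional
construction from the middle level on with Fact 1 (H4)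
(`Literature.Topology.FourManifolds.Matveyev1996_partOne_and_fact_of_dualSpheres`: Matveyev
pp. 1–3; Kirby 1996 §3 and Addenda (B), (C)), by
`matveyev1996_partOne_and_fact_of_eightOne_middleLevel`.
Once (B) and (H4) are discharged, `Matveyev1996_partOne_and_fact_holds` is this theorem applied
to their `_holds`.
[cite: Matveyev1996, Theorem 1 part 1, Proof of Theorem (first sentence, arXiv p. 1) and Fact 1 (arXiv pp. 1–3)]
[cite: KirbyCorks1996, §§2–4: Theorem and Addenda (B), (C)]
[cite: MilnorHCobordism1965, Thm. 8.1 and its proof (PDF pp. 54–57), proof of Thm. 5.4, Assertion 6 (PDF pp. 31–32)] -/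
theorem matveyev1996_partOne_and_fact_of_middleLevel_leaves
    (hB : exists_dualSpheres_middleLevel_of_two_three.{u})
    (h4 : Matveyev1996_partOne_and_fact_of_dualSpheres.{u}) :
    Matveyev1996_partOne_and_fact.{u} :=
  matveyev1996_partOne_and_fact_of_eightOne_middleLevel
    Cobordism.Milnor1965_exists_isMorseFunction_two_le_index_left_holds hB h4

end Literature.Topology.FourManifolds

end
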